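import Summits.HodgeConjecture.HodgeConjecture.Theorems.R90S6ShellSphereDictU3   -- ★ p07 W8-d `mem_orbit_torusGen_pow_iff_dist_eq_three`; brings ★ W7-i `R90S6CartanShellSphere` (§1 orbit–stabiliser dictionary) and ★ `TreeLayers.dist_iso_apply`
import HarnessLib

/-!
# R90 · S6 «Ch. 14.1–14.5 stable trace formula» — WAVE 8 card W8-j (J2, the U(3) reading): COSETS `yK₀` WITH `y⁻¹ γ y` IN THE `m`-TH CARTAN SHELL
# ↔ HYPERSPECIAL VERTICES DISPLACED BY `γ` BY EXACTLY `2m` (`Theorems/R90S6EllipticOrbitalDisplacement.lean`)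

DAG r5 row E1.3.5.2.1 «UNFOLDING at displacement m» (dealer R90-C14-plan (g2) card W8-j, census verdict + cut 2026-09-04T23:59Z, statement box S6#W8-j (J2) CLEAN
2026-09-05T00:00:49Z).  `K` a discretely valued field with the cell's unramified datum `hd : UnramifiedLocalConjDatum σ ϖ`, `U = U(σ, J₀)(K)` the quasi-split unitary
group in three variables, `K₀ = unitaryInt σ J₀` (hyperspecial), `t = hd.torusGen = diag(ϖ, 1, ϖ⁻¹)`, `X` the lattice tree `latticeGraph σ ϖ J₀` of `(K³, J₀)` with
root `x₀ = 𝒪³`.  For every `γ ∈ U` and `m ∈ ℕ`: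

  **`#{q ∈ U ⧸ K₀ : q.out⁻¹ γ q.out ∈ K₀ tᵐ K₀} = #{x ∈ X hyperspecial : dist(x, γ·x) = 2m}`**

(shell membership in the ORBIT currency of the W7∕W8 sheets: `(q.out⁻¹ γ q.out) K₀ ∈ K₀ · (tᵐ K₀)`).  PROOF: `q ↦ q.out · x₀` is a bijection from `U ⧸ K₀` onto the
self-dual vertices (★ W7-i §1: `latticeGraphIso_apartmentEnum_zero_eq_latticeGraphIso_iff` — injective on cosets —, `exists_latticeGraphIso_apartmentEnum_zero_eq_iff` —
onto the hyperspecial vertices), `dist(q.out·x₀, γ q.out·x₀) = dist(x₀, (q.out⁻¹ γ q.out)·x₀)` (★ `TreeLayers.dist_iso_apply` for the automorphism `q.out`), and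
«`(q.out⁻¹ γ q.out) K₀ ∈ K₀ tᵐ K₀ ∕ K₀ ⟺ dist(x₀, (q.out⁻¹ γ q.out)·x₀) = 2m`» is ★ p07 W8-d `mem_orbit_torusGen_pow_iff_dist_eq_three`; `Set.ncard_congr` (both sides may be
infinite together — no finiteness binder).  With the generic count ★ (J1) `R90.S6.orbitalIntegral_indicator_quotientMeasure_eq_mul_ncard_shell` (compact centraliser):
Rogawski's `Φ(γ, φ_m) = ν(K₀) · #{x hyperspecial : d(x, γx) = 2m}` for elliptic `γ` [Rogawski1990 §4.9 pp. 54–55; Kottwitz1986 §3].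

Cell `hodgecm-mathlib`, crux H413 (`stmt-HodgeConjecture-24833`), route of record `HCCMUnconditional`; programme R90-TF (brief `director/R90-BRIEF.v2.md`
1f40d54518340a35), section S6 (base `R90-C14`), seat R90-C14-p03 (g2).  Lane `--kind proof --supports stmt-HodgeConjecture-24833 --as helper`; ONE public theorem (+ one
transport lemma) over ★ carriers (no definition, no instance, no notation, no named fact, no kit, no `sorry`); Theorems import Theorems (p07's W7-i ∕ W8-d), never `Lines/`.
HONEST LABEL: lattice-model bookkeeping, count-neutral until the E1.3.5.2 ∕ E1.3.9 assemblies consume it; proves no printed global statement, discharges no citation;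
HC_CM is proved only modulo the 7 printed citations (2 remaining named inputs: hLiu418 = stmt-HodgeConjecture-24832, h413 = stmt-HodgeConjecture-24833) until rung 0 closes.

## References
* [Rogawski1990] J. D. Rogawski, *Automorphic Representations of Unitary Groups in Three Variables*, Ann. of Math. Stud. 123 (1990): §4.9 pp. 54–55.
* [Kottwitz1986BaseChangeUnits] R. E. Kottwitz, *Base change for unit elements of Hecke algebras*, Compositio Math. 60 (1986): §3.
* [BruhatTits1972] F. Bruhat, J. Tits, *Groupes réductifs sur un corps local I*, Publ. Math. IHÉS 41 (1972): §10, (4.4.3).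
* [Serre1980Trees] J.-P. Serre, *Trees* (1980): Ch. II §1.1.
-/

set_option autoImplicit false
-- the mandated namespace repeats the single-problem summit's segment (`HodgeConjecture.HodgeConjecture`)
set_option linter.dupNamespace false

noncomputable section

open scoped Valued WithZero Matrix MatrixGroups
open MulAction
open Literature.NumberTheory.Automorphic Literature.NumberTheory.Automorphic.HermitianLattice
open Literature.NumberTheory.Automorphic.UnitaryLatticeTree
open Literature.Combinatorics.SimpleGraph (TreeLayers.dist_iso_apply)

namespace Summit.HodgeConjecture.HodgeConjecture.R90.S6

variable {K : Type*} [Field K] [Valued K ℤᵐ⁰] {σ : K →+* K} {ϖ : K}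

/-- **Transport of the displacement to the root**: `dist(u·x, γ·(u·x)) = dist(x, (u⁻¹ γ u)·x)` for `u, γ ∈ U(σ, H)` and any vertex `x` (the automorphism `u` of
the lattice graph is an isometry, ★ `TreeLayers.dist_iso_apply`). [cite: Serre1980Trees, Ch. II §1.1] [cite: BruhatTits1972, §10] -/
theorem dist_latticeGraphPerm_latticeGraphPerm_mul_eq {N : ℕ} (H : Matrix (Fin N) (Fin N) K) (u γ : unitaryGroupOfForm σ H)
    (x : {M : Submodule 𝒪[K] (Fin N → K) // IsVertex σ ϖ H M}) :
    (latticeGraph σ ϖ H).dist (latticeGraphPerm σ ϖ H u x) (latticeGraphPerm σ ϖ H γ (latticeGraphPerm σ ϖ H u x)) =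
      (latticeGraph σ ϖ H).dist x (latticeGraphPerm σ ϖ H (u⁻¹ * γ * u) x) := by
  have h1 : latticeGraphPerm σ ϖ H γ (latticeGraphPerm σ ϖ H u x) = latticeGraphIso σ ϖ H u (latticeGraphPerm σ ϖ H (u⁻¹ * γ * u) x) := by
    apply Subtype.ext
    change mapGL (γ : GL (Fin N) K) (mapGL (u : GL (Fin N) K) x.1) =
      mapGL (u : GL (Fin N) K) (mapGL ((u⁻¹ * γ * u : unitaryGroupOfForm σ H) : GL (Fin N) K) x.1)
    rw [← mapGL_mul, ← mapGL_mul, Subgroup.coe_mul, Subgroup.coe_mul, Subgroup.coe_inv, ← mul_assoc, ← mul_assoc, mul_inv_cancel, one_mul]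
  rw [h1]
  exact TreeLayers.dist_iso_apply (latticeGraphIso σ ϖ H u) x _

/-- **W8-j (J2) THE ELLIPTIC READING: cosets `yK₀` with `y⁻¹ γ y` in the `m`-th Cartan shell ↔ hyperspecial vertices displaced by `γ` by exactly `2m`.**
For `γ ∈ U(σ, J₀)(K)` and `m ∈ ℕ`,
`#{q ∈ U ⧸ K₀ : (q.out⁻¹ γ q.out) K₀ ∈ K₀ · tᵐ K₀} = #{x : X | x self-dual ∧ dist(x, γ·x) = 2m}`
(`Set.ncard` on both sides; `q ↦ q.out · 𝒪³` is the bijection, ★ W7-i §1 + ★ W8-d + `dist_latticeGraphPerm_latticeGraphPerm_mul_eq`).  With ★ (J1)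
`orbitalIntegral_indicator_quotientMeasure_eq_mul_ncard_shell`: `Φ(γ, 1_{K₀tᵐK₀}) = ν(K₀) · #{x hyperspecial : d(x, γx) = 2m}` at a compact centraliser.
[cite: Rogawski1990, §4.9 pp. 54–55] [cite: Kottwitz1986BaseChangeUnits, §3] [cite: BruhatTits1972, §10] -/
theorem ncard_quotient_shell_eq_ncard_selfDual_displaced (hd : UnramifiedLocalConjDatum σ ϖ)
    (γ : unitaryGroupOfForm σ ((StdForm.antidiagonal 3).over K)) (m : ℕ) :
    {q : unitaryGroupOfForm σ ((StdForm.antidiagonal 3).over K) ⧸ unitaryInt σ ((StdForm.antidiagonal 3).over K) |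
        ((q.out⁻¹ * γ * q.out : unitaryGroupOfForm σ ((StdForm.antidiagonal 3).over K)) :
            unitaryGroupOfForm σ ((StdForm.antidiagonal 3).over K) ⧸ unitaryInt σ ((StdForm.antidiagonal 3).over K)) ∈
          MulAction.orbit (unitaryInt σ ((StdForm.antidiagonal 3).over K))
            ((hd.torusGen ^ m : unitaryGroupOfForm σ ((StdForm.antidiagonal 3).over K)) :
              unitaryGroupOfForm σ ((StdForm.antidiagonal 3).over K) ⧸ unitaryInt σ ((StdForm.antidiagonal 3).over K))}.ncard =
      {x : {M : Submodule 𝒪[K] (Fin 3 → K) // IsVertex σ ϖ ((StdForm.antidiagonal 3).over K) M} |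
        IsSelfDualLattice σ ϖ ((StdForm.antidiagonal 3).over K) x.1 ∧
          (latticeGraph σ ϖ ((StdForm.antidiagonal 3).over K)).dist x (latticeGraphPerm σ ϖ ((StdForm.antidiagonal 3).over K) γ x) = 2 * m}.ncard := by
  obtain ⟨A, hA0, hA1⟩ := exists_apartmentEnum hd
  -- the root `x₀ = 𝒪³ = A 0`
  set x₀ : {M : Submodule 𝒪[K] (Fin 3 → K) // IsVertex σ ϖ ((StdForm.antidiagonal 3).over K) M} :=
    ⟨stdLattice K 3, 0, isSelfDualLattice_stdLattice_three_of_v hd.vϖ⟩ with hx₀def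
  have hx₀ : x₀.1 = stdLattice K 3 := rfl
  have h0 : A 0 = x₀ := Subtype.ext (coe_apartmentEnum_zero A hA0)
  -- the dictionary for the conjugate `q.out⁻¹ γ q.out`, read at the vertex `q.out · x₀`
  have key : ∀ u : unitaryGroupOfForm σ ((StdForm.antidiagonal 3).over K),
      ((u⁻¹ * γ * u : unitaryGroupOfForm σ ((StdForm.antidiagonal 3).over K)) :
            unitaryGroupOfForm σ ((StdForm.antidiagonal 3).over K) ⧸ unitaryInt σ ((StdForm.antidiagonal 3).over K)) ∈
          MulAction.orbit (unitaryInt σ ((StdForm.antidiagonal 3).over K))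
            ((hd.torusGen ^ m : unitaryGroupOfForm σ ((StdForm.antidiagonal 3).over K)) :
              unitaryGroupOfForm σ ((StdForm.antidiagonal 3).over K) ⧸ unitaryInt σ ((StdForm.antidiagonal 3).over K)) ↔
        (latticeGraph σ ϖ ((StdForm.antidiagonal 3).over K)).dist (latticeGraphPerm σ ϖ ((StdForm.antidiagonal 3).over K) u x₀)
          (latticeGraphPerm σ ϖ ((StdForm.antidiagonal 3).over K) γ (latticeGraphPerm σ ϖ ((StdForm.antidiagonal 3).over K) u x₀)) = 2 * m := by
    intro u
    rw [dist_latticeGraphPerm_latticeGraphPerm_mul_eq, mem_orbit_torusGen_pow_iff_dist_eq_three hd x₀ hx₀]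
  refine Set.ncard_congr (fun q _ => latticeGraphPerm σ ϖ ((StdForm.antidiagonal 3).over K) q.out x₀) (fun q hq => ?_)
    (fun q q' _ _ h => ?_) (fun y hy => ?_)
  · -- INTO: `q.out · x₀` is hyperspecial and displaced by `2m`
    refine ⟨(isVertexLattice_mapGL_iff σ ϖ ((StdForm.antidiagonal 3).over K) q.out x₀.1).2 (isSelfDualLattice_stdLattice_three_of_v hd.vϖ), ?_⟩
    exact (key q.out).1 hq
  · -- INJECTIVE: equal root translates ⇒ equal cosets (★ W7-i §1)
    have h' := (latticeGraphIso_apartmentEnum_zero_eq_latticeGraphIso_iff A hA0 q.out q'.out).1 (by rw [h0]; exact h)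
    rwa [QuotientGroup.out_eq', QuotientGroup.out_eq'] at h'
  · -- ONTO: a displaced hyperspecial vertex is `u · x₀`, and `(mk u).out · x₀ = u · x₀`
    obtain ⟨hy, hdist⟩ := hy
    obtain ⟨u, hu⟩ := (exists_latticeGraphIso_apartmentEnum_zero_eq_iff hd A hA0 y).2 hy
    rw [h0] at hu
    -- `latticeGraphIso u` and `latticeGraphPerm u` agree on vertices (definitionally)
    have hu' : latticeGraphPerm σ ϖ ((StdForm.antidiagonal 3).over K) u x₀ = y := hu
    have hout : latticeGraphPerm σ ϖ ((StdForm.antidiagonal 3).over K)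
        (((u : unitaryGroupOfForm σ ((StdForm.antidiagonal 3).over K) ⧸ unitaryInt σ ((StdForm.antidiagonal 3).over K)).out)) x₀ =
          latticeGraphPerm σ ϖ ((StdForm.antidiagonal 3).over K) u x₀ := by
      have := latticeGraphIso_out_coe_apartmentEnum_zero A hA0 u
      rw [h0] at this
      exact this
    refine ⟨(u : unitaryGroupOfForm σ ((StdForm.antidiagonal 3).over K) ⧸ unitaryInt σ ((StdForm.antidiagonal 3).over K)), ?_, ?_⟩
    · rw [Set.mem_setOf_eq, key, hout, hu']
      exact hdist
    · rw [hout, hu']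

end Summit.HodgeConjecture.HodgeConjecture.R90.S6

end
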